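import Mathlib.Analysis.SpecialFunctions.Complex.Circle
import Mathlib.Analysis.SpecialFunctions.Trigonometric.Basic
import Mathlib.Analysis.SpecialFunctions.Sqrt

/-!
# Crux `DlogGraphFlat` (stmt-QuantumAdvantage-10732), line `Sketch_holder_energy` — the EXACT
# two-step transfer constant (`stub_heTwoStep`)

For every choice of signs `σ, σ' ∈ {±1}` and every real `φ`,
`Σ_{r<4} ‖1 + σ e((φ+r)/2)‖ · ‖1 + σ' e((φ+r)/4)‖ ≤ 4 √(2 + √2)`, `e(t) = exp(2πi t)`.

Proof. Write `w_σ(t) = ‖1 + σ e(t)‖`, so `w_σ(t)² = 2 + 2σ cos(2πt)` (`norm_sq_one_add_sign_mul_cexp`).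
The first factors `X_r = w_σ((φ+r)/2)` satisfy `X₂ = X₀`, `X₃ = X₁`, `X₀² + X₁² = 4`; the second
factors `Y_r = w_{σ'}((φ+r)/4)` satisfy `Σ Y_r² = 8` and `Y₀²Y₂² + Y₁²Y₃² = 4` (the cosines at the four
quarter-shifted points are `c, -s, -c, s` with `c² + s² = 1`). Hence the sum is
`X₀(Y₀+Y₂) + X₁(Y₁+Y₃) ≤ √(X₀²+X₁²) · √((Y₀+Y₂)² + (Y₁+Y₃)²) = 2 √(8 + 2(Y₀Y₂ + Y₁Y₃))` and
`(Y₀Y₂ + Y₁Y₃)² ≤ 2 (Y₀²Y₂² + Y₁²Y₃²) = 8`, i.e. `Y₀Y₂ + Y₁Y₃ ≤ 2√2`; altogether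
`≤ 2 √(8 + 4√2) = 4 √(2 + √2)` (`two_step_real_ineq`, two Cauchy–Schwarz steps; the constant is sharp,
equality at `|cos(πφ/2)| = |sin(πφ/2)|`). Mathlib trigonometry only.
-/

set_option linter.dupNamespace false -- D-0017: single-problem summit ⇒ `QuantumAdvantage.QuantumAdvantage` by design

namespace Summit.QuantumAdvantage.QuantumAdvantage.Theorems.SymplecticPurity

/-- `‖1 + σ e(t)‖² = 2 + 2σ cos(2πt)` for a real sign `σ` (`σ² = 1`), `e(t) = exp(2πi t)`. -/
theorem norm_sq_one_add_sign_mul_cexp (σ t : ℝ) (hσ : σ * σ = 1) :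
    ‖(1 : ℂ) + (σ : ℂ) * Complex.exp (2 * Real.pi * Complex.I * (t : ℂ))‖ ^ 2 =
      2 + 2 * σ * Real.cos (2 * Real.pi * t) := by
  have h : (2 * Real.pi * Complex.I * (t : ℂ) : ℂ) = ((2 * Real.pi * t : ℝ) : ℂ) * Complex.I := by
    push_cast; ring
  rw [h, Complex.sq_norm, Complex.normSq_apply]
  simp only [Complex.add_re, Complex.one_re, Complex.mul_re, Complex.ofReal_re, Complex.ofReal_im,
    Complex.exp_ofReal_mul_I_re, Complex.exp_ofReal_mul_I_im, zero_mul, sub_zero, Complex.add_im,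
    Complex.one_im, Complex.mul_im, zero_add, add_zero]
  linear_combination (σ * σ) * Real.cos_sq_add_sin_sq (2 * Real.pi * t) + hσ

/-- The real inequality behind the two-step constant: if `x₀² + x₁² = 4`, `x₂ = x₀`, `x₃ = x₁`
(as nonnegative square roots), `Σ yᵢ² = 8` and `y₀²y₂² + y₁²y₃² = 4`, then
`Σ xᵢyᵢ ≤ 4√(2+√2)` — two Cauchy–Schwarz steps. -/
theorem two_step_real_ineq (x0 x1 x2 x3 y0 y1 y2 y3 : ℝ)
    (h0 : 0 ≤ x0) (h1 : 0 ≤ x1) (h2 : 0 ≤ x2) (h3 : 0 ≤ x3) (hx : x0 ^ 2 + x1 ^ 2 = 4) (hx2 : x2 ^ 2 = x0 ^ 2) (hx3 : x3 ^ 2 = x1 ^ 2)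
    (hy : y0 ^ 2 + y1 ^ 2 + y2 ^ 2 + y3 ^ 2 = 8) (hyy : y0 ^ 2 * y2 ^ 2 + y1 ^ 2 * y3 ^ 2 = 4) :
    x0 * y0 + x1 * y1 + x2 * y2 + x3 * y3 ≤ 4 * Real.sqrt (2 + Real.sqrt 2) := by
  have e2 : x2 = x0 := by rw [← Real.sqrt_sq h2, hx2, Real.sqrt_sq h0]
  have e3 : x3 = x1 := by rw [← Real.sqrt_sq h3, hx3, Real.sqrt_sq h1]
  rw [e2, e3]
  set s := Real.sqrt 2 with hs_def
  have hs0 : 0 ≤ s := Real.sqrt_nonneg _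
  have hs2 : s ^ 2 = 2 := Real.sq_sqrt (by norm_num)
  have ht0 : 0 ≤ Real.sqrt (2 + s) := Real.sqrt_nonneg _
  have ht2 : Real.sqrt (2 + s) ^ 2 = 2 + s := Real.sq_sqrt (by positivity)
  -- first Cauchy–Schwarz: `Y₀Y₂ + Y₁Y₃ ≤ 2√2`
  have hP : y0 * y2 + y1 * y3 ≤ 2 * s := by
    refine le_of_sq_le_sq ?_ (by positivity)
    nlinarith [sq_nonneg (y0 * y2 - y1 * y3)]
  -- second Cauchy–Schwarz: `X₀ S₀ + X₁ S₁ ≤ √(X₀²+X₁²) √(S₀²+S₁²)`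
  have e1 : (x0 ^ 2 + x1 ^ 2) * ((y0 + y2) ^ 2 + (y1 + y3) ^ 2) =
      4 * ((y0 + y2) ^ 2 + (y1 + y3) ^ 2) := by rw [hx]
  refine le_of_sq_le_sq ?_ (by positivity)
  nlinarith [sq_nonneg (x0 * (y1 + y3) - x1 * (y0 + y2))]

/-- **Stub B4a (exact constant): the two-step transfer inequality.** For every choice of signs and
every real `φ`, `Σ_{r<4} ‖1 ± e((φ+r)/2)‖ · ‖1 ±' e((φ+r)/4)‖ ≤ 4 √(2 + √2)`, `e(t) = exp(2πi t)`. -/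
theorem stub_heTwoStep : ∀ (a a' : Bool) (φ : ℝ),
    ∑ r ∈ Finset.range 4,
      ‖(1 : ℂ) + (if a then -1 else 1) *
          Complex.exp (2 * Real.pi * Complex.I * (((φ + (r : ℝ)) / 2 : ℝ) : ℂ))‖ *
      ‖(1 : ℂ) + (if a' then -1 else 1) *
          Complex.exp (2 * Real.pi * Complex.I * (((φ + (r : ℝ)) / 4 : ℝ) : ℂ))‖
      ≤ 4 * Real.sqrt (2 + Real.sqrt 2) := by
  intro a a' φ
  obtain ⟨σ, hσ, hσa⟩ : ∃ σ : ℝ, σ * σ = 1 ∧ ((if a then -1 else 1 : ℂ) = (σ : ℂ)) := by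
    cases a
    · exact ⟨1, by norm_num, by simp⟩
    · exact ⟨-1, by norm_num, by simp⟩
  obtain ⟨τ, hτ, hτa⟩ : ∃ τ : ℝ, τ * τ = 1 ∧ ((if a' then -1 else 1 : ℂ) = (τ : ℂ)) := by
    cases a'
    · exact ⟨1, by norm_num, by simp⟩
    · exact ⟨-1, by norm_num, by simp⟩
  simp only [hσa, hτa, Finset.sum_range_succ, Finset.sum_range_zero, zero_add, Nat.cast_zero,
    add_zero, Nat.cast_one, Nat.cast_ofNat]
  -- the eight squared weights
  have hX0 := norm_sq_one_add_sign_mul_cexp σ (φ / 2) hσ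
  have hX1 := norm_sq_one_add_sign_mul_cexp σ ((φ + 1) / 2) hσ
  have hX2 := norm_sq_one_add_sign_mul_cexp σ ((φ + 2) / 2) hσ
  have hX3 := norm_sq_one_add_sign_mul_cexp σ ((φ + 3) / 2) hσ
  have hY0 := norm_sq_one_add_sign_mul_cexp τ (φ / 4) hτ
  have hY1 := norm_sq_one_add_sign_mul_cexp τ ((φ + 1) / 4) hτ
  have hY2 := norm_sq_one_add_sign_mul_cexp τ ((φ + 2) / 4) hτ
  have hY3 := norm_sq_one_add_sign_mul_cexp τ ((φ + 3) / 4) hτ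
  have c1 : Real.cos (2 * Real.pi * ((φ + 1) / 2)) = -Real.cos (2 * Real.pi * (φ / 2)) := by
    rw [show 2 * Real.pi * ((φ + 1) / 2) = 2 * Real.pi * (φ / 2) + Real.pi by ring, Real.cos_add_pi]
  have c2 : Real.cos (2 * Real.pi * ((φ + 2) / 2)) = Real.cos (2 * Real.pi * (φ / 2)) := by
    rw [show 2 * Real.pi * ((φ + 2) / 2) = 2 * Real.pi * (φ / 2) + 2 * Real.pi by ring,
      Real.cos_add_two_pi]
  have c3 : Real.cos (2 * Real.pi * ((φ + 3) / 2)) = -Real.cos (2 * Real.pi * (φ / 2)) := by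
    rw [show 2 * Real.pi * ((φ + 3) / 2) = 2 * Real.pi * (φ / 2) + Real.pi + 2 * Real.pi by ring,
      Real.cos_add_two_pi, Real.cos_add_pi]
  have d1 : Real.cos (2 * Real.pi * ((φ + 1) / 4)) = -Real.sin (2 * Real.pi * (φ / 4)) := by
    rw [show 2 * Real.pi * ((φ + 1) / 4) = 2 * Real.pi * (φ / 4) + Real.pi / 2 by ring,
      Real.cos_add_pi_div_two]
  have d2 : Real.cos (2 * Real.pi * ((φ + 2) / 4)) = -Real.cos (2 * Real.pi * (φ / 4)) := by
    rw [show 2 * Real.pi * ((φ + 2) / 4) = 2 * Real.pi * (φ / 4) + Real.pi by ring, Real.cos_add_pi]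
  have d3 : Real.cos (2 * Real.pi * ((φ + 3) / 4)) = Real.sin (2 * Real.pi * (φ / 4)) := by
    rw [show 2 * Real.pi * ((φ + 3) / 4) = 2 * Real.pi * (φ / 4) + Real.pi / 2 + Real.pi by ring,
      Real.cos_add_pi, Real.cos_add_pi_div_two, neg_neg]
  rw [c1] at hX1
  rw [c2] at hX2
  rw [c3] at hX3
  rw [d1] at hY1
  rw [d2] at hY2
  rw [d3] at hY3
  have hcs := Real.cos_sq_add_sin_sq (2 * Real.pi * (φ / 4))
  refine two_step_real_ineq _ _ _ _ _ _ _ _ (norm_nonneg _) (norm_nonneg _) (norm_nonneg _)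
    (norm_nonneg _) ?_ ?_ ?_ ?_ ?_
  · rw [hX0, hX1]; ring
  · rw [hX2, hX0]
  · rw [hX3, hX1]
  · rw [hY0, hY1, hY2, hY3]; ring
  · rw [hY0, hY1, hY2, hY3]
    linear_combination (-4 * τ * τ) * hcs - 4 * hτ

end Summit.QuantumAdvantage.QuantumAdvantage.Theorems.SymplecticPurity
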